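import Summits.AtomisticToContinuum.HydrodynamicLimit.Theorems.MourreKoopmanChargesLinearToEntropyInBandDefs
import Summits.AtomisticToContinuum.HydrodynamicLimit.Theorems.OneFlightGossipEngineEnergyCurrentTailsSplitFirstPartner
import Summits.AtomisticToContinuum.HydrodynamicLimit.Theorems.OneFlightGossipEngineEnergyCurrentTailsEnergyFluxCeilingOneRareDock
import HarnessLib

/-!
# Route `MourreKoopmanCharges`, crux `LinearToEntropyInBand` (stmt-AtomisticToContinuum-17740), line `registered`:
# stub 2 `stub_energyCurrentTailsInBand` — by-name glue onto the blocking heads of stmt-9235 (wave 2)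

Stub 2 of the skeleton is the packing-guarded cubic uniform integrability of the energy current,
`LTEInBand.EnergyCurrentTailsInBand`, the guarded (hence weaker) form of the shared crux
`EnergyCurrentTails` (stmt-AtomisticToContinuum-9235; the copies
`BallwiseInvariantReferences.EnergyCurrentTails`, `OneFlightGossipEngine.EnergyCurrentTails`,
`WarmColdDichotomy.EnergyCurrentTails` are the same `Prop` by `rfl`).  No landed chain proves the crux
outright (audit of `Theorems/`, 2026-08-17): every landed head concluding a copy of `EnergyCurrentTails`
is conditional.  The sharpest one is the final composition of the line `quartic-schur-ledger` (seat c6,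
reshape B), `QuarticSchurLedger.EnergyCurrentTails_of_firstPartner : T′ → I′ → S2a″ → EnergyCurrentTails`,
whose open heads are exactly

* T′ = `EnergyCurrentTailsFirstPartner.FirstPartnerFloorMeso` (registered stub `stub_firstPartnerFloor`
  of stmt-9235: static mesoscopic first-partner floor under the fixed-time law — OPEN),
* I′ = `EnergyCurrentTailsFirstPartner.FirstPartnerRealisedShare` (registered stub
  `stub_firstPartnerDisturbanceCeiling` of stmt-9235: one-rare short-window realised share — OPEN),
* S2a″ = the all-windows energy-flux ceiling (registered stub `stub_energyFluxCeilingWindows` of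
  stmt-9235, inline), whose typed producer is the shared item
  `JeansLoadedDice.ContactIntensityDominationOneRare` (stmt-AtomisticToContinuum-16939 — OPEN) through
  the landed dock `QuarticSchurLedger.stub_energyFluxCeilingWindows_of_oneRare`.

This file records those heads BY NAME in the vocabulary of crux 17740:

* `glue_energyCurrentTailsInBand_of_firstPartner : T′ → I′ → ContactIntensityDominationOneRare →
  EnergyCurrentTailsInBand`, and the coarser
* `glue_energyCurrentTailsInBand_of_mixingFloor4L : QMF₄ᴸ → ContactIntensityDominationOneRare →
  EnergyCurrentTailsInBand` through `QuarticSchurLedger.EnergyCurrentTails_of_mixingFloor4L`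
  (QMF₄ᴸ = `EnergyCurrentTailsFirstPartner.QuarticMixingFloor4L`, itself derived from T′, I′ and the
  landed sure kinematics `stub_firstPartnerPathwise` on the 9235 side).

Both are registered glue stubs of stmt-17740 (wave 2) and two-line compositions of landed theorems with `LTEInBand.energyCurrentTailsInBand_of_unguarded`
(take `η := 1`, ignore the guard).  The packing guard `ρ_t(x)σ³ < η` of the stub constrains only the
classical Euler solution, which none of the three open heads mentions (they are Euler-free statements,
uniform over flow families under the local Gibbs law), so the guard does not shorten this chain.
-/

noncomputable section

namespace Summit.AtomisticToContinuum.HydrodynamicLimit.Theorems.LTEInBand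

open Summit.AtomisticToContinuum.HydrodynamicLimit.Theses
open Summit.AtomisticToContinuum.HydrodynamicLimit.Theorems.QuarticSchurLedger

/-- **Registered glue stub `glue_energyCurrentTailsInBand_of_firstPartner`** (crux stmt-17740, line
`registered`, wave 2 of stub 2): the packing-guarded cubic tails `EnergyCurrentTailsInBand` follow from
the three OPEN heads of the shared crux stmt-9235 taken BY NAME — the mesoscopic first-partner floor T′,
the first-partner realised share I′, and the one-rare-participant contact-intensity ceiling
(stmt-16939, typed producer of the all-windows energy-flux ceiling S2a″).  Proof:
`energyCurrentTailsInBand_of_unguarded ∘ EnergyCurrentTails_of_firstPartner`, with S2a″ supplied by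
`stub_energyFluxCeilingWindows_of_oneRare` (the `OneFlightGossipEngine` copy concluded by the 9235
composition and the `BallwiseInvariantReferences` copy consumed by `energyCurrentTailsInBand_of_unguarded`
are the same term, so the composition type-checks by `rfl`). -/
theorem glue_energyCurrentTailsInBand_of_firstPartner :
    Summit.AtomisticToContinuum.HydrodynamicLimit.Theorems.EnergyCurrentTailsFirstPartner.FirstPartnerFloorMeso →
    Summit.AtomisticToContinuum.HydrodynamicLimit.Theorems.EnergyCurrentTailsFirstPartner.FirstPartnerRealisedShare →
    Summit.AtomisticToContinuum.HydrodynamicLimit.Theses.JeansLoadedDice.ContactIntensityDominationOneRare →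
    Summit.AtomisticToContinuum.HydrodynamicLimit.Theorems.LTEInBand.EnergyCurrentTailsInBand :=
  fun hT hI hOR => energyCurrentTailsInBand_of_unguarded
    (EnergyCurrentTails_of_firstPartner hT hI (stub_energyFluxCeilingWindows_of_oneRare hOR))

/-- **Registered glue stub `glue_energyCurrentTailsInBand_of_mixingFloor4L`** — the coarser glue through
the lagged kinetic-window quartic mixing floor QMF₄ᴸ (seat c6 reshape A of stmt-9235):
`QuarticMixingFloor4L → ContactIntensityDominationOneRare → EnergyCurrentTailsInBand`, by
`energyCurrentTailsInBand_of_unguarded ∘ EnergyCurrentTails_of_mixingFloor4L` with S2a″ from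
`stub_energyFluxCeilingWindows_of_oneRare`. -/
theorem glue_energyCurrentTailsInBand_of_mixingFloor4L :
    Summit.AtomisticToContinuum.HydrodynamicLimit.Theorems.EnergyCurrentTailsFirstPartner.QuarticMixingFloor4L →
    Summit.AtomisticToContinuum.HydrodynamicLimit.Theses.JeansLoadedDice.ContactIntensityDominationOneRare →
    Summit.AtomisticToContinuum.HydrodynamicLimit.Theorems.LTEInBand.EnergyCurrentTailsInBand :=
  fun hQ hOR => energyCurrentTailsInBand_of_unguarded
    (EnergyCurrentTails_of_mixingFloor4L hQ (stub_energyFluxCeilingWindows_of_oneRare hOR))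

end Summit.AtomisticToContinuum.HydrodynamicLimit.Theorems.LTEInBand

end
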